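import Summits.Ventures.HSemireg.WedgeHankelRecurrenceExtension
import Summits.Ventures.HSemireg.WedgeHankelRecurrenceLevel
import Summits.Ventures.HSemireg.WedgeHankelRankProfileRecurrence

/-!
# Venture HSemireg — AFFINE AND POLAR CLASSES AND THEIR LEVEL TRANSITIONS: every class of middle rank `r` on `[0, N]` is either AFFINE (its minimal window carries a recurrence of full
# degree `r`: no node at infinity) or POLAR (every recurrence of the minimal window drops degree: a node at infinity), never both; reading one more coefficient (`2r ≤ N + 1`) an
# AFFINE class of rank `r` either stays affine of rank `r` (exactly when the new coefficient continues its recurrence) or becomes POLAR of rank `r + 1`, a POLAR class of rank `r`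
# ALWAYS becomes polar of rank `r + 1` — **the edge `2r = N + 1` of the window included** — and a generic class of an even level `2t` becomes AFFINE of rank `t + 1`; conversely the
# class of rank `r` at level `N + 1` determines the rank and the type at level `N` — the transition table of the `F_s`-census by middle rank

HONEST FRAMING. Part of the Lean index of the computation cell `pub-hsemireg` (seat p10 gen 28, Sunday typer «UNIFORM-IN-n»).
LINEAR ALGEBRA OF HANKEL (catalecticant) MATRICES and of polynomials over a field ONLY: no variety, no cohomology theory, no sheaf, no Ext group and no semiregularity map is constructed
here; nothing here says that HC / HC_CM / HC_AV holds; no Literature fact is declared or used.  Custodian versions as in `WedgeHankelSiegelIdeal` (1/3); the dictionary (`R^N(q) = rank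
H^N_{⌊N/2⌋}(q)` the middle rank on `[0, N]`; «affine» = apolar scheme inside the affine line, «polar» = a point of the apolar scheme at `∞`, N34) is QUOTED, never asserted.

WHAT IS IN THE TREE.  N42 (`WedgeHankelRecurrenceLevel`, № 275): `rank_half_le_level_succ`, `rank_half_level_succ_le_add_one`, `rank_half_level_succ_of_mem`, `rank_half_level_succ_of_not_mem`,
`rank_half_level_succ_of_top`, `natDegree_eq_of_mem_recSpace_top`; N34 (№ 267): `exists_dualSeq_eq_below_of_mem_recSpace`, `tail_apply_ne_zero`, `rank_hankel1_half_congr`; N40 (№ 273)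
`exists_monic_mem_recSpace'`; N32 (№ 263) `mem_recSpace_dualSeq`; N17 (№ 156) `rank_hankel1_half_eq_zero_iff`; N29 (№ 237) `mem_recSpace_succ_succ_iff`; N23 (№ 176) `recSpace_congr`;
N18 (№ 173): `recSpace`, `mem_recSpace_iff`, `hkFun_monomial`, `finrank_recSpace_self`, `exists_recSpace_self_eq_span`, `finiteDimensional_recSpace`, `natDegree_le_of_mem_recSpace`,
`mem_degreeLT_succ_iff`.  Mathlib: `finrank_eq_one_iff_of_nonzero'`, `Polynomial.natDegree_C_mul`, `Matrix.rank_le_height`.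
THIS FILE (namespace `Summit.Ventures.HSemireg.Wedge.HankelOuter` continued; PLAIN on tree files N40 + N42 + N17; 2 definitions `IsAffineClass`, `IsPolarClass`):
* §539 **`not_mem_recSpace_level_succ_of_polar`** (`R^N(q) = d + e`, `e ≥ 1`, `0 ≠ m ∈ Rec^N_{d+e}(q)` of degree `d` ⇒ `m ∉ Rec^{N+1}_{d+e}(q)`, NO window: the affine part read one
  coefficient further would kill the leading polar coefficient of N34), **`rank_half_level_succ_of_polar`** (`2(d + e) ≤ N + 1 ⇒ R^{N+1}(q) = d + e + 1`; N40 had `2(d + e) ≤ N`),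
  `exists_smul_eq_of_mem_recSpace_self` (the minimal window is a line: `m′ = c • m`), `natDegree_eq_of_mem_recSpace_self`.
* §540 THE TWO TYPES: `IsAffineClass K N r q` / `IsPolarClass K N r q`; `isAffineClass_or_isPolarClass` (cover), `IsAffineClass.not_isPolarClass` (disjoint), `isAffineClass_congr`,
  `isPolarClass_congr` (read `q` on `[0, N]`), `not_isPolarClass_zero`, **`isAffineClass_zero_iff`** (`↔ q = 0` on `[0, N]`, N17), `IsPolarClass.exists_mem` (a degree-dropping generator).
* §541 FORWARD TRANSITIONS (`2r ≤ N + 1`): from an AFFINE class — **`IsAffineClass.isAffineClass_level_succ_iff`** (`↔ m ∈ Rec^{N+1}_r(q)` for any full-degree generator `m`),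
  `IsAffineClass.not_isPolarClass_level_succ`, and for `2r ≤ N` **`IsAffineClass.isPolarClass_level_succ_iff`** (`IsPolarClass (N+1) (r+1) ↔ m ∉ Rec^{N+1}_r(q)`),
  `IsAffineClass.not_isAffineClass_level_succ_succ`; from a POLAR class — **`IsPolarClass.rank_level_succ`** (`R^{N+1}(q) = r + 1`), `IsPolarClass.not_isAffineClass_level_succ`,
  `IsPolarClass.not_isPolarClass_level_succ`, and for `2r ≤ N` **`IsPolarClass.isPolarClass_level_succ`**, `IsPolarClass.not_isAffineClass_level_succ_succ`; from a GENERIC class of an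
  even level — **`isAffineClass_level_succ_of_top`**, `not_isPolarClass_level_succ_of_top`.
* §542 BACKWARD TRANSITIONS: **`IsAffineClass.of_level_succ`** (affine of rank `r` at `N + 1`, `2r ≤ N + 1` ⇒ affine of rank `r` at `N`), **`IsPolarClass.rank_eq_of_level_succ`** (polar of
  rank `d + 1` at `N + 1`, `2d ≤ N` ⇒ rank `d` at `N`), **`rank_eq_top_of_isAffineClass_level_succ`** (affine of rank `t + 1` at `2t + 1` ⇒ rank `t + 1` at `2t`).
READING: over `F_s` these are the fibre sizes `1 ∕ s − 1 ∕ s ∕ s` of the census by middle rank (next leaf): the affine classes of rank `r` at level `N + 1` sit over the affine classes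
of rank `r` (one coefficient each), the polar classes of rank `d + 1` over the affine (`s − 1` coefficients) and the polar (`s`) classes of rank `d`, the affine classes of top rank
`t + 1` at an odd level over the generic classes of the even level below (`s`).  Nothing Ext-side.  New names only.
-/

open Module Polynomial
open scoped Matrix Polynomial

namespace Summit.Ventures.HSemireg.Wedge.HankelOuter

open Summit.Ventures.HSemireg.Wedge Summit.Ventures.HSemireg.Wedge.Hankel

variable (K : Type*) [Field K] {N : ℕ}

/-! ## §539. A node at infinity always steps up (edge included); the minimal window is a line -/

/-- **A POLAR CLASS BREAKS ITS RECURRENCE AT THE NEXT LEVEL, WHATEVER THE NEW COEFFICIENT IS: `R^N(q) = d + e`, `e ≥ 1`, `0 ≠ m ∈ Rec^N_{d+e}(q)` of degree `d` ⇒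
`m ∉ Rec^{N+1}_{d+e}(q)`** (no window hypothesis) — else N34's affine part would agree with `q` one index further and kill the leading polar coefficient `(q − u)_{N+1−e} ≠ 0`. -/
theorem not_mem_recSpace_level_succ_of_polar {d e : ℕ} {q : ℕ → K} {m : K[X]} (he : 1 ≤ e) (hm0 : m ≠ 0) (hmd : m.natDegree = d)
    (hq : (hankel1 K N (N / 2) q).rank = d + e) (hm : m ∈ recSpace K N q (d + e)) : m ∉ recSpace K (N + 1) q (d + e) := by
  intro hmem
  obtain ⟨m₁, hmo, hdeg, -, hiff⟩ := exists_monic_mem_recSpace' K hm hm0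
  rw [hmd] at hdeg
  have hrle : (hankel1 K N (N / 2) q).rank ≤ N / 2 + 1 := Matrix.rank_le_height _
  have h1 : m₁ ∈ recSpace K (N + 1) q (m₁.natDegree + e) := by rw [hdeg]; exact (hiff (N + 1) (d + e)).mp hmem
  obtain ⟨a, -, haff⟩ := exists_dualSeq_eq_below_of_mem_recSpace K hmo (by omega) h1
  have haff' : ∀ j, j + e ≤ N → q j = dualSeq K m₁ a j := fun j hj => haff j (by omega)
  have hne := tail_apply_ne_zero K hq (show m₁.natDegree + e = d + e by rw [hdeg]) haff' (mem_recSpace_dualSeq K (N := N) hmo a) hmo.ne_zero he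
  exact hne (by rw [Pi.sub_apply, haff (N + 1 - e) (by omega), sub_self])

/-- **A NODE AT INFINITY GAINS ONE ORDER, THE EDGE OF THE WINDOW INCLUDED: `R^N(q) = d + e`, `e ≥ 1`, `0 ≠ m ∈ Rec^N_{d+e}(q)` of degree `d`, `2(d + e) ≤ N + 1 ⇒
R^{N+1}(q) = d + e + 1` and `m ∈ Rec^{N+1}_{d+e+1}(q)`** (N40 `rank_half_succ_of_polar` had `2(d + e) ≤ N`). -/
theorem rank_half_level_succ_of_polar {d e : ℕ} {q : ℕ → K} {m : K[X]} (he : 1 ≤ e) (hm0 : m ≠ 0) (hmd : m.natDegree = d)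
    (hq : (hankel1 K N (N / 2) q).rank = d + e) (hm : m ∈ recSpace K N q (d + e)) (h2 : d + e + (d + e) ≤ N + 1) :
    (hankel1 K (N + 1) ((N + 1) / 2) q).rank = d + e + 1 ∧ m ∈ recSpace K (N + 1) q (d + e + 1) :=
  ⟨rank_half_level_succ_of_not_mem K hq hm h2 (not_mem_recSpace_level_succ_of_polar K he hm0 hmd hq hm),
    (mem_recSpace_succ_succ_iff K ((mem_degreeLT_succ_iff K).mpr (by omega))).mpr hm⟩

/-- **the minimal window is a line: for `R^N(q) = r`, `2r ≤ N + 1` and `0 ≠ m ∈ Rec^N_r(q)`, every `m′ ∈ Rec^N_r(q)` is `c • m`.** -/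
theorem exists_smul_eq_of_mem_recSpace_self {r : ℕ} {q : ℕ → K} (hq : (hankel1 K N (N / 2) q).rank = r) (h2 : r + r ≤ N + 1) {m m' : K[X]}
    (hm : m ∈ recSpace K N q r) (hm0 : m ≠ 0) (hm' : m' ∈ recSpace K N q r) : ∃ c : K, m' = c • m := by
  haveI := finiteDimensional_recSpace K (N := N) q r
  have h1 := finrank_recSpace_self K hq h2
  have hv : (⟨m, hm⟩ : recSpace K N q r) ≠ 0 := fun h => hm0 (congrArg Subtype.val h)
  obtain ⟨c, hc⟩ := (finrank_eq_one_iff_of_nonzero' _ hv).mp h1 ⟨m', hm'⟩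
  exact ⟨c, (congrArg Subtype.val hc).symm⟩

/-- hence all non-zero members of the minimal window have the same degree. -/
theorem natDegree_eq_of_mem_recSpace_self {r : ℕ} {q : ℕ → K} (hq : (hankel1 K N (N / 2) q).rank = r) (h2 : r + r ≤ N + 1) {m m' : K[X]}
    (hm : m ∈ recSpace K N q r) (hm0 : m ≠ 0) (hm' : m' ∈ recSpace K N q r) (hm0' : m' ≠ 0) : m'.natDegree = m.natDegree := by
  obtain ⟨c, rfl⟩ := exists_smul_eq_of_mem_recSpace_self K hq h2 hm hm0 hm'
  have hc : c ≠ 0 := by rintro rfl; exact hm0' (zero_smul K m)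
  rw [Polynomial.smul_eq_C_mul, Polynomial.natDegree_C_mul hc]

/-! ## §540. The two types of a class of middle rank `r`: affine (no node at infinity) and polar (a node at infinity) -/

/-- AN AFFINE CLASS OF MIDDLE RANK `r` ON `[0, N]`: `R^N(q) = r` and the minimal window `Rec^N_r(q)` carries a non-zero recurrence of FULL degree `r` (quoted: the apolar scheme of
the class misses the point at infinity). [definition of this file] -/
def IsAffineClass (N r : ℕ) (q : ℕ → K) : Prop :=
  (hankel1 K N (N / 2) q).rank = r ∧ ∃ m ∈ recSpace K N q r, m ≠ 0 ∧ m.natDegree = r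

/-- A POLAR CLASS OF MIDDLE RANK `r` ON `[0, N]`: `R^N(q) = r` and every non-zero recurrence of the minimal window has degree `< r` (quoted: the apolar scheme contains the point at
infinity; by N34 the degree drop is its multiplicity). [definition of this file] -/
def IsPolarClass (N r : ℕ) (q : ℕ → K) : Prop :=
  (hankel1 K N (N / 2) q).rank = r ∧ ∀ m ∈ recSpace K N q r, m ≠ 0 → m.natDegree < r

variable {K}

/-- an affine class has middle rank `r`. -/
theorem IsAffineClass.rank_eq {r : ℕ} {q : ℕ → K} (h : IsAffineClass K N r q) : (hankel1 K N (N / 2) q).rank = r := h.1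

/-- a polar class has middle rank `r`. -/
theorem IsPolarClass.rank_eq {r : ℕ} {q : ℕ → K} (h : IsPolarClass K N r q) : (hankel1 K N (N / 2) q).rank = r := h.1

/-- **the two types are disjoint.** -/
theorem IsAffineClass.not_isPolarClass {r : ℕ} {q : ℕ → K} (h : IsAffineClass K N r q) : ¬ IsPolarClass K N r q := by
  obtain ⟨-, m, hm, hm0, hmd⟩ := h
  intro hP
  have := hP.2 m hm hm0
  omega

variable (K)

/-- **every class of middle rank `r` is affine or polar.** -/
theorem isAffineClass_or_isPolarClass {r : ℕ} {q : ℕ → K} (hq : (hankel1 K N (N / 2) q).rank = r) : IsAffineClass K N r q ∨ IsPolarClass K N r q := by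
  by_cases h : ∃ m ∈ recSpace K N q r, m ≠ 0 ∧ m.natDegree = r
  · exact Or.inl ⟨hq, h⟩
  · refine Or.inr ⟨hq, fun m hm hm0 => lt_of_le_of_ne (natDegree_le_of_mem_recSpace K hm) fun hmd => h ⟨m, hm, hm0, hmd⟩⟩

/-- the type reads `q` on `[0, N]` only (affine). -/
theorem isAffineClass_congr {r : ℕ} {q q' : ℕ → K} (h : ∀ j ≤ N, q j = q' j) : IsAffineClass K N r q ↔ IsAffineClass K N r q' := by
  unfold IsAffineClass
  rw [rank_hankel1_half_congr K h, recSpace_congr K h]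

/-- the type reads `q` on `[0, N]` only (polar). -/
theorem isPolarClass_congr {r : ℕ} {q q' : ℕ → K} (h : ∀ j ≤ N, q j = q' j) : IsPolarClass K N r q ↔ IsPolarClass K N r q' := by
  unfold IsPolarClass
  rw [rank_hankel1_half_congr K h, recSpace_congr K h]

/-- there is no polar class of rank `0` (the zero class has the recurrence `1`). -/
theorem not_isPolarClass_zero (q : ℕ → K) : ¬ IsPolarClass K N 0 q := by
  rintro ⟨hq, h⟩
  obtain ⟨m, hm0, hspan⟩ := exists_recSpace_self_eq_span K hq (by omega)
  exact Nat.not_lt_zero _ (h m (by rw [hspan]; exact Submodule.mem_span_singleton_self m) hm0)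

/-- **the affine classes of rank `0` are the zero class: `IsAffineClass K N 0 q ↔ q_j = 0` for all `j ≤ N`.** -/
theorem isAffineClass_zero_iff (q : ℕ → K) : IsAffineClass K N 0 q ↔ ∀ j ≤ N, q j = 0 := by
  rw [← rank_hankel1_half_eq_zero_iff]
  constructor
  · exact fun h => h.rank_eq
  · intro hq
    rcases isAffineClass_or_isPolarClass K hq with h | h
    · exact h
    · exact absurd h (not_isPolarClass_zero K q)

variable {K}

/-- a polar class of rank `r` (`2r ≤ N + 1`) has a non-zero recurrence `m` in its minimal window, of some degree `d` with `r = d + e`, `e ≥ 1`. -/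
theorem IsPolarClass.exists_mem {r : ℕ} {q : ℕ → K} (h : IsPolarClass K N r q) (h2 : r + r ≤ N + 1) :
    ∃ (m : K[X]) (d e : ℕ), m ∈ recSpace K N q r ∧ m ≠ 0 ∧ m.natDegree = d ∧ 1 ≤ e ∧ d + e = r := by
  obtain ⟨m, hm0, hspan⟩ := exists_recSpace_self_eq_span K h.1 h2
  have hm : m ∈ recSpace K N q r := by rw [hspan]; exact Submodule.mem_span_singleton_self m
  have hlt := h.2 m hm hm0
  exact ⟨m, m.natDegree, r - m.natDegree, hm, hm0, rfl, by omega, by omega⟩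

/-! ## §541. Forward transitions: one more coefficient, starting from an affine, a polar or a generic class -/

section FromAffine

variable {r : ℕ} {q : ℕ → K} (hA : IsAffineClass K N r q) (h2 : r + r ≤ N + 1)
include hA h2

/-- **FROM AN AFFINE CLASS (`2r ≤ N + 1`): the class stays affine of rank `r` at level `N + 1` iff the new coefficient continues a (any) full-degree generator `m` of the minimal
window, `m ∈ Rec^{N+1}_r(q)`.** -/
theorem IsAffineClass.isAffineClass_level_succ_iff {m : K[X]} (hm : m ∈ recSpace K N q r) (hm0 : m ≠ 0) (hmd : m.natDegree = r) :
    IsAffineClass K (N + 1) r q ↔ m ∈ recSpace K (N + 1) q r := by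
  constructor
  · intro h
    by_contra hmem
    have := rank_half_level_succ_of_not_mem K hA.1 hm h2 hmem
    have := h.rank_eq
    omega
  · intro hmem
    exact ⟨rank_half_level_succ_of_mem K hA.1 hm hm0 hmd h2 hmem, m, hmem, hm0, hmd⟩

/-- … equivalently iff the rank stays `r`. -/
theorem IsAffineClass.isAffineClass_level_succ_iff_rank : IsAffineClass K (N + 1) r q ↔ (hankel1 K (N + 1) ((N + 1) / 2) q).rank = r := by
  obtain ⟨hq, m, hm, hm0, hmd⟩ := hA
  have hA' : IsAffineClass K N r q := ⟨hq, m, hm, hm0, hmd⟩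
  rw [hA'.isAffineClass_level_succ_iff h2 hm hm0 hmd]
  constructor
  · exact fun hmem => rank_half_level_succ_of_mem K hq hm hm0 hmd h2 hmem
  · intro h
    by_contra hmem
    have := rank_half_level_succ_of_not_mem K hq hm h2 hmem
    omega

/-- **an affine class of rank `r` never becomes polar of rank `r`.** -/
theorem IsAffineClass.not_isPolarClass_level_succ : ¬ IsPolarClass K (N + 1) r q := by
  obtain ⟨hq, m, hm, hm0, hmd⟩ := hA
  intro hP
  rcases rank_half_level_succ_dichotomy K hq hm hm0 hmd h2 with ⟨hmem, -⟩ | ⟨-, h⟩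
  · have := hP.2 m hmem hm0; omega
  · have := hP.rank_eq; omega

omit h2 in
/-- **FROM AN AFFINE CLASS (`2r ≤ N`): the class becomes POLAR of rank `r + 1` iff the new coefficient breaks the generator, `m ∉ Rec^{N+1}_r(q)`** — the broken generator (degree `r`)
spans the new minimal window `Rec^{N+1}_{r+1}(q)`. -/
theorem IsAffineClass.isPolarClass_level_succ_iff (h2' : r + r ≤ N) {m : K[X]} (hm : m ∈ recSpace K N q r) (hm0 : m ≠ 0) (hmd : m.natDegree = r) :
    IsPolarClass K (N + 1) (r + 1) q ↔ m ∉ recSpace K (N + 1) q r := by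
  have hm1 : m ∈ recSpace K (N + 1) q (r + 1) := (mem_recSpace_succ_succ_iff K ((mem_degreeLT_succ_iff K).mpr hmd.le)).mpr hm
  constructor
  · intro hP hmem
    have := rank_half_level_succ_of_mem K hA.1 hm hm0 hmd (by omega) hmem
    have := hP.rank_eq
    omega
  · intro hmem
    have hr1 := rank_half_level_succ_of_not_mem K hA.1 hm (by omega) hmem
    refine ⟨hr1, fun m' hm' hm0' => ?_⟩
    rw [natDegree_eq_of_mem_recSpace_self K hr1 (by omega) hm1 hm0 hm' hm0', hmd]
    exact Nat.lt_succ_self r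

omit h2 in
/-- **… and never becomes affine of rank `r + 1`** (`2r ≤ N`: the new minimal window is the line through the old generator, of degree `r`). -/
theorem IsAffineClass.not_isAffineClass_level_succ_succ (h2' : r + r ≤ N) : ¬ IsAffineClass K (N + 1) (r + 1) q := by
  obtain ⟨hq, m, hm, hm0, hmd⟩ := hA
  rintro ⟨hr1, m', hm', hm0', hmd'⟩
  have hm1 : m ∈ recSpace K (N + 1) q (r + 1) := (mem_recSpace_succ_succ_iff K ((mem_degreeLT_succ_iff K).mpr hmd.le)).mpr hm
  have := natDegree_eq_of_mem_recSpace_self K hr1 (by omega) hm1 hm0 hm' hm0'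
  omega

end FromAffine

section FromPolar

variable {r : ℕ} {q : ℕ → K} (hP : IsPolarClass K N r q) (h2 : r + r ≤ N + 1)
include hP h2

/-- **FROM A POLAR CLASS (`2r ≤ N + 1`): the rank ALWAYS steps up, `R^{N+1}(q) = r + 1`** (§539). -/
theorem IsPolarClass.rank_level_succ : (hankel1 K (N + 1) ((N + 1) / 2) q).rank = r + 1 := by
  obtain ⟨m, d, e, hm, hm0, hmd, he, hde⟩ := hP.exists_mem h2
  subst hde
  exact (rank_half_level_succ_of_polar K he hm0 hmd hP.1 hm h2).1

/-- … so it is neither affine of rank `r` at level `N + 1` … -/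
theorem IsPolarClass.not_isAffineClass_level_succ : ¬ IsAffineClass K (N + 1) r q := fun h => by
  have := hP.rank_level_succ h2; have := h.rank_eq; omega

/-- … nor polar of rank `r`. -/
theorem IsPolarClass.not_isPolarClass_level_succ : ¬ IsPolarClass K (N + 1) r q := fun h => by
  have := hP.rank_level_succ h2; have := h.rank_eq; omega

omit h2 in
/-- **FROM A POLAR CLASS (`2r ≤ N`): the class is POLAR of rank `r + 1` at level `N + 1`, whatever the new coefficient is** (the old generator, of degree `< r`, spans the new window). -/
theorem IsPolarClass.isPolarClass_level_succ (h2' : r + r ≤ N) : IsPolarClass K (N + 1) (r + 1) q := by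
  obtain ⟨m, d, e, hm, hm0, hmd, he, hde⟩ := hP.exists_mem (by omega)
  subst hde
  obtain ⟨hr1, hm1⟩ := rank_half_level_succ_of_polar K he hm0 hmd hP.1 hm (by omega)
  refine ⟨hr1, fun m' hm' hm0' => ?_⟩
  rw [natDegree_eq_of_mem_recSpace_self K hr1 (by omega) hm1 hm0 hm' hm0', hmd]
  omega

omit h2 in
/-- … and not affine of rank `r + 1`. -/
theorem IsPolarClass.not_isAffineClass_level_succ_succ (h2' : r + r ≤ N) : ¬ IsAffineClass K (N + 1) (r + 1) q :=
  fun h => h.not_isPolarClass (hP.isPolarClass_level_succ h2')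

end FromPolar

variable (K)

/-- **FROM A GENERIC CLASS OF AN EVEN LEVEL: `R^{2t}(q) = t + 1 ⇒` the class is AFFINE of rank `t + 1` at level `2t + 1`, whatever the new coefficient is** (N42 §538: the rank
persists and no node at infinity is created). -/
theorem isAffineClass_level_succ_of_top {t : ℕ} {q : ℕ → K} (hq : (hankel1 K (2 * t) (2 * t / 2) q).rank = t + 1) : IsAffineClass K (2 * t + 1) (t + 1) q := by
  have hr := rank_half_level_succ_of_top K hq
  obtain ⟨m, hm0, hspan⟩ := exists_recSpace_self_eq_span K hr (by omega)
  have hm : m ∈ recSpace K (2 * t + 1) q (t + 1) := by rw [hspan]; exact Submodule.mem_span_singleton_self m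
  exact ⟨hr, m, hm, hm0, natDegree_eq_of_mem_recSpace_top K hq hm hm0⟩

/-- … and not polar. -/
theorem not_isPolarClass_level_succ_of_top {t : ℕ} {q : ℕ → K} (hq : (hankel1 K (2 * t) (2 * t / 2) q).rank = t + 1) : ¬ IsPolarClass K (2 * t + 1) (t + 1) q :=
  (isAffineClass_level_succ_of_top K hq).not_isPolarClass

/-! ## §542. Backward transitions: the class at level `N + 1` determines the rank and the type at level `N` -/

variable {K}

/-- **AN AFFINE CLASS OF RANK `r` AT LEVEL `N + 1` (`2r ≤ N + 1`) WAS AFFINE OF RANK `r` AT LEVEL `N`** (a polar class of rank `r` and both types of rank `r − 1` are excluded by §541;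
other ranks by N42's `R^N ≤ R^{N+1} ≤ R^N + 1`). -/
theorem IsAffineClass.of_level_succ {r : ℕ} {q : ℕ → K} (h : IsAffineClass K (N + 1) r q) (h2 : r + r ≤ N + 1) : IsAffineClass K N r q := by
  have hlo := rank_half_le_level_succ K (N := N) q
  have hhi := rank_half_level_succ_le_add_one K (N := N) q
  rw [h.rank_eq] at hlo hhi
  rcases Nat.lt_or_ge (hankel1 K N (N / 2) q).rank r with hlt | hge
  · -- rank `r − 1` below: impossible
    exfalso
    obtain ⟨d, rfl⟩ : ∃ d, r = d + 1 := ⟨r - 1, by omega⟩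
    have hd : (hankel1 K N (N / 2) q).rank = d := by omega
    rcases isAffineClass_or_isPolarClass K hd with hA | hP
    · exact hA.not_isAffineClass_level_succ_succ (by omega) h
    · exact hP.not_isAffineClass_level_succ_succ (by omega) h
  · have hr : (hankel1 K N (N / 2) q).rank = r := le_antisymm hlo hge
    rcases isAffineClass_or_isPolarClass K hr with hA | hP
    · exact hA
    · exact absurd h (hP.not_isAffineClass_level_succ h2)

/-- **A POLAR CLASS OF RANK `d + 1` AT LEVEL `N + 1` (`2d ≤ N`) HAD RANK `d` AT LEVEL `N`** (rank `d + 1` at level `N` is excluded: affine ⇒ not polar at `N + 1`, polar ⇒ rank `d + 2`,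
generic of an even level ⇒ affine). -/
theorem IsPolarClass.rank_eq_of_level_succ {d : ℕ} {q : ℕ → K} (h : IsPolarClass K (N + 1) (d + 1) q) (h2 : d + d ≤ N) : (hankel1 K N (N / 2) q).rank = d := by
  have hlo := rank_half_le_level_succ K (N := N) q
  have hhi := rank_half_level_succ_le_add_one K (N := N) q
  rw [h.rank_eq] at hlo hhi
  by_contra hne
  have hd1 : (hankel1 K N (N / 2) q).rank = d + 1 := by omega
  rcases Nat.lt_or_ge (N + 1) (d + 1 + (d + 1)) with hlt | hle
  · -- the generic classes of the even level `N = 2d`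
    obtain rfl : N = 2 * d := by omega
    exact not_isPolarClass_level_succ_of_top K hd1 h
  · rcases isAffineClass_or_isPolarClass K hd1 with hA | hP
    · exact hA.not_isPolarClass_level_succ hle h
    · exact hP.not_isPolarClass_level_succ hle h

/-- **AN AFFINE CLASS OF TOP RANK `t + 1` AT THE ODD LEVEL `2t + 1` WAS GENERIC (`R^{2t}(q) = t + 1`) AT LEVEL `2t`** (rank `t` below is excluded by §541). -/
theorem rank_eq_top_of_isAffineClass_level_succ {t : ℕ} {q : ℕ → K} (h : IsAffineClass K (2 * t + 1) (t + 1) q) : (hankel1 K (2 * t) (2 * t / 2) q).rank = t + 1 := by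
  have hlo := rank_half_le_level_succ K (N := 2 * t) q
  have hhi := rank_half_level_succ_le_add_one K (N := 2 * t) q
  rw [h.rank_eq] at hlo hhi
  by_contra hne
  have ht : (hankel1 K (2 * t) (2 * t / 2) q).rank = t := by omega
  rcases isAffineClass_or_isPolarClass K ht with hA | hP
  · exact hA.not_isAffineClass_level_succ_succ (by omega) h
  · exact hP.not_isAffineClass_level_succ_succ (by omega) h

end Summit.Ventures.HSemireg.Wedge.HankelOuter
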